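import Literature.MathematicalPhysics.QuantumLattice.RegionalNumberCharge
import Literature.MathematicalPhysics.QuantumLattice.HubbardModel
import HarnessLib

/-!
# Block decompositions of pair-sourced Hubbard Hamiltonians: embedded blocks, boundary terms, number gradings

Topic `MathematicalPhysics/QuantumLattice` (finite-volume bookkeeping for the thermodynamic limit and for
two-phase trial states of lattice fermions; consumer: the thermal wedge of the Hubbard summit). For a finite
linearly ordered site set `Λ`, a graph `G` (hopping `t`), real `U, μ, h` and PAIR WEIGHTS `w : Λ × Λ → ℂ`, the
pair-sourced grand-canonical Hubbard Hamiltonian is (written out, no definition)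

  `H(G, w, μ) = hamiltonianWith G t U μ − h (P_w + P_wᴴ)`,  `P_w = Σ_{(x,y)} w(x,y) b_{xy}`,

`b_{xy} = c_{x↑}c_{y↓} − c_{x↓}c_{y↑}` (`Literature.Barriers.HubbardSuperconductivity.bondPair`). A small system
`(Λ₁, G₁, w₁)` is placed into `Λ` by a FAMILY of order embeddings `e_j : Λ₁ ↪o Λ` (`j ∈ T`) with pairwise disjoint
ranges, compatible adjacency and weights. Everything is PROVED; no definition and no named fact:

* `jwEmbed_sourced_eq_intrinsic` / `jwEmbed_sourced_eq` — the second quantisation `(e_j)_* H(G₁, w₁, μ)` is the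
  on-site operator of the range minus the image bonds and image pairs of the BIG couplings;
* **cutting into blocks** (`sourced_sub_sum_jwEmbed_sub_onSiteSum_eq`, `norm_sourced_sub_sum_jwEmbed_sub_onSiteSum_le`):
  `H(G,w,μ) − Σ_j (e_j)_* H(G₁,w₁,μ) − V_{(⋃ ranges)ᶜ}(U, μ)` is minus the bonds and pairs not inside a block, of
  norm `≤ (2|t| + 4|h|) · #{ordered adjacent pairs not inside a block}` (Ruelle's boundary estimate);
* **chemical potentials per block** (`sum_jwEmbed_sourced_shift`): subtracting `Σ_j μ_j N_{block j} + μ_r N_{rest}`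
  from the `μ = 0` block sum gives the block sum at chemical potentials `μ_j` (and `μ_r` on the atomic rest);
* **number gradings** (`doubleComm_numberDiag_jwEmbed_sourced_of_subset/_of_disjoint`,
  `norm_doubleComm_blockSum_le`): for the particle number `N_A` of a union `A` of blocks, only the pair sources
  of the blocks inside `A` fail to commute, and `‖[N_A, [Σ_j (e_j)_* H_j + V, N_A]]‖ ≤ #{blocks in A} · 16|h| Σ_z ‖w₁ z‖`
  (the double commutators of the Falk–Bruch inequality for block trial states);
* Hermiticity of all these operators.

References: D. Ruelle, *Statistical Mechanics: Rigorous Results* (1969), §2.2–2.3 (boundary terms of block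
decompositions) [cite: Ruelle1969, §2.2]; O. Bratteli, D. W. Robinson, *Operator Algebras and QSM II* (1997), §5.2.2
(isotony of local CAR algebras) [cite: BratteliRobinsonII1997, §5.2.2]; F. J. Dyson, E. H. Lieb, B. Simon,
J. Stat. Phys. 18 (1978) 335, §3 (double commutators in the Falk–Bruch inequality). All statements are [folklore].
Statements mentioning `diagonal`, `⋃` or `ᶜ` over the big site set are parametric in its `DecidableEq` instance (see the
design note of `RegionalNumberCharge.lean`).

Re-homing note: a few one-line tools (`hamiltonianWith_eq_onSiteSum_sub_hopSum`, `norm_sum_smul_le_mul_sum`,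
`norm_add_conjTranspose_le_two_mul`, `norm_hubbardCoupling_ofReal`, `jwEmbed_bondPair`, `jwEmbed_pairSum`,
`isHermitian_sourced`, `isHermitian_onSiteSum_ofReal`, `isHermitian_jwEmbed_of_isHermitian`) restate
at Literature level bookkeeping so far proved only inside `Summits/…/Theorems` support files of the Hubbard summit
(`twR_*` of `…TwSeededEnsembleEquivalenceRBondSums`, `…Regions`, `…Factorisation`), which Literature may not import; the
block-family results are new.
-/

noncomputable section

open Matrix Finset Literature.Barriers.HubbardSuperconductivity
open scoped Matrix.Norms.L2Operator

namespace Literature.MathematicalPhysics.QuantumLattice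

/-! ### One site set: the sourced Hamiltonian as on-site part minus bonds and pairs -/

section Generic

variable {Λ : Type*} [LinearOrder Λ] [Fintype Λ]

/-- `H_G(t,U) − μN = V_Λ(U, μ) − Σ_b c_b T_b` with the Hubbard couplings `c = t · 1_{bonds of G}`. [folklore] -/
theorem hamiltonianWith_eq_onSiteSum_sub_hopSum (G : SimpleGraph Λ) [DecidableRel G.Adj] (t U μ : ℝ) :
    hamiltonianWith G t U μ =
      onSiteSum (U : ℂ) (μ : ℂ) (Finset.univ : Finset Λ) - hopSum (hubbardCoupling G (t : ℂ)) := by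
  rw [hamiltonianWith_eq_hoppingForm_add_diagonal, hopSum_hubbardCoupling, ← onSiteSum_univ, neg_smul]
  abel

/-- Chemical potential shift: `hamiltonianWith G t U μ = hamiltonianWith G t U 0 − μ N`. [folklore] -/
theorem hamiltonianWith_eq_sub_smul_totalNumber (G : SimpleGraph Λ) [DecidableRel G.Adj] (t U μ : ℝ) :
    hamiltonianWith G t U μ = hamiltonianWith G t U 0 - (μ : ℂ) • totalNumber := by
  rw [hamiltonianWith_eq, hamiltonianWith_eq, Complex.ofReal_zero, zero_smul, sub_zero]

/-- `H(G, w, μ)` is Hermitian for real `t, U, μ, h`. [folklore] -/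
theorem isHermitian_sourced (G : SimpleGraph Λ) [DecidableRel G.Adj] (t U μ h : ℝ) (w : Λ × Λ → ℂ) :
    (hamiltonianWith G t U μ - (h : ℂ) • ((∑ z : Λ × Λ, w z • bondPair z.1 z.2) + (∑ z : Λ × Λ, w z • bondPair z.1 z.2)ᴴ)).IsHermitian := by
  refine (isHermitian_hamiltonianWith G t U μ).sub ?_
  have hS : ((∑ z : Λ × Λ, w z • bondPair z.1 z.2) + (∑ z : Λ × Λ, w z • bondPair z.1 z.2)ᴴ).IsHermitian :=
    Matrix.isHermitian_add_transpose_self _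
  unfold IsHermitian at hS ⊢
  rw [conjTranspose_smul, hS, Complex.star_def, Complex.conj_ofReal]

/-- The on-site operator `V_R(U, μ)` is Hermitian for real `U, μ`. [folklore] -/
theorem isHermitian_onSiteSum_ofReal (U μ : ℝ) (R : Finset Λ) : (onSiteSum (U : ℂ) (μ : ℂ) R).IsHermitian := by
  rw [onSiteSum_eq_diagonal]
  refine Matrix.isHermitian_diagonal_of_self_adjoint _ (funext fun s => ?_)
  simp only [Pi.star_apply, onSiteEnergyAt, star_sum, star_sub, star_mul', Complex.star_def, Complex.conj_ofReal]
  refine Finset.sum_congr rfl fun x _ => ?_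
  congr 1
  · congr 1; split_ifs <;> simp
  · congr 1
    rw [map_add]
    congr 1 <;> split_ifs <;> simp

omit [LinearOrder Λ] [Fintype Λ] in
/-- Norm of a weighted sum of uniformly bounded operators. [folklore] -/
theorem norm_sum_smul_le_mul_sum {ι n : Type*} [Fintype n] [DecidableEq n] (s : Finset ι) (c : ι → ℂ)
    (A : ι → Matrix n n ℂ) {B : ℝ} (hA : ∀ i ∈ s, ‖A i‖ ≤ B) :
    ‖∑ i ∈ s, c i • A i‖ ≤ B * ∑ i ∈ s, ‖c i‖ := by
  rw [Finset.mul_sum]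
  refine (norm_sum_le _ _).trans (Finset.sum_le_sum fun i hi => ?_)
  rw [norm_smul, mul_comm]
  exact mul_le_mul_of_nonneg_right (hA i hi) (norm_nonneg _)

omit [LinearOrder Λ] [Fintype Λ] in
/-- `‖X + Xᴴ‖ ≤ 2‖X‖`. [folklore] -/
theorem norm_add_conjTranspose_le_two_mul {n : Type*} [Fintype n] [DecidableEq n] (X : Matrix n n ℂ) :
    ‖X + Xᴴ‖ ≤ 2 * ‖X‖ := by
  refine (norm_add_le _ _).trans ?_
  rw [Matrix.l2_opNorm_conjTranspose]
  linarith

omit [LinearOrder Λ] [Fintype Λ] in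
/-- `‖c_b‖ = |t| · 1_{adjacent}` for the Hubbard couplings. [folklore] -/
theorem norm_hubbardCoupling_ofReal (G : SimpleGraph Λ) [DecidableRel G.Adj] (t : ℝ) (b : Bond Λ) :
    ‖hubbardCoupling G (t : ℂ) b‖ = |t| * (if G.Adj b.1 b.2.1 then 1 else 0) := by
  rw [hubbardCoupling_apply]
  split_ifs <;> simp

/-- **Norm of a boundary operator**: `‖−Σ_{b ∈ S} c_b T_b − h(Q + Qᴴ)‖ ≤ Σ_{b ∈ S} ‖c_b‖ + 4|h| Σ_{z ∈ P} ‖w z‖`,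
`Q = Σ_{z ∈ P} w z b_z`. [folklore] -/
theorem norm_neg_bondSum_sub_pairSum_le (S : Finset (Bond Λ)) (P : Finset (Λ × Λ)) (c : Bond Λ → ℂ) (h : ℝ)
    (w : Λ × Λ → ℂ) :
    ‖-(∑ b ∈ S, c b • bondOp b) - (h : ℂ) • ((∑ z ∈ P, w z • bondPair z.1 z.2) + (∑ z ∈ P, w z • bondPair z.1 z.2)ᴴ)‖ ≤
      ∑ b ∈ S, ‖c b‖ + 4 * |h| * ∑ z ∈ P, ‖w z‖ := by
  have h1 : ‖∑ b ∈ S, c b • bondOp b‖ ≤ ∑ b ∈ S, ‖c b‖ := by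
    have := norm_sum_smul_le_mul_sum S c (fun b => bondOp b) (B := 1) (fun b _ =>
      (norm_mul_le _ _).trans (mul_le_one₀ (norm_creation_le_one _) (norm_nonneg _) (norm_annihilation_le_one _)))
    simpa using this
  have h2 : ‖∑ z ∈ P, w z • bondPair z.1 z.2‖ ≤ 2 * ∑ z ∈ P, ‖w z‖ :=
    norm_sum_smul_le_mul_sum P w (fun z => bondPair z.1 z.2) (fun z _ => norm_bondPair_le_two _ _)
  have h3 := norm_add_conjTranspose_le_two_mul (∑ z ∈ P, w z • bondPair z.1 z.2)
  calc ‖-(∑ b ∈ S, c b • bondOp b) - (h : ℂ) • ((∑ z ∈ P, w z • bondPair z.1 z.2) + (∑ z ∈ P, w z • bondPair z.1 z.2)ᴴ)‖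
      ≤ ‖-(∑ b ∈ S, c b • bondOp b)‖ + ‖(h : ℂ) • ((∑ z ∈ P, w z • bondPair z.1 z.2) + (∑ z ∈ P, w z • bondPair z.1 z.2)ᴴ)‖ :=
        norm_sub_le _ _
    _ ≤ ∑ b ∈ S, ‖c b‖ + |h| * (2 * (2 * ∑ z ∈ P, ‖w z‖)) := by
        rw [norm_neg, norm_smul, Complex.norm_real, Real.norm_eq_abs]
        exact add_le_add h1 (mul_le_mul_of_nonneg_left (h3.trans (by linarith)) (abs_nonneg h))
    _ = ∑ b ∈ S, ‖c b‖ + 4 * |h| * ∑ z ∈ P, ‖w z‖ := by ring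

omit [LinearOrder Λ] [Fintype Λ] in
/-- **Boundary sums are controlled by the number of ordered adjacent pairs**: for nearest-neighbour weights bounded by
`1`, `Σ_{b ∈ S} ‖c_b‖ + 4|h| Σ_{z ∈ P} ‖w z‖ ≤ (2|t| + 4|h|) · #{z ∈ P | z adjacent}` whenever every bond of `S` with
adjacent ends has its site pair in `P`. [folklore] -/
theorem bondSum_add_pairSum_le_card (G : SimpleGraph Λ) [DecidableRel G.Adj] (t h : ℝ) (w : Λ × Λ → ℂ)
    (hw : ∀ z, ‖w z‖ ≤ if G.Adj z.1 z.2 then 1 else 0) (S : Finset (Bond Λ)) (P : Finset (Λ × Λ))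
    (hSP : ∀ b ∈ S, G.Adj b.1 b.2.1 → (b.1, b.2.1) ∈ P) :
    ∑ b ∈ S, ‖hubbardCoupling G (t : ℂ) b‖ + 4 * |h| * ∑ z ∈ P, ‖w z‖ ≤
      (2 * |t| + 4 * |h|) * ((P.filter fun z => G.Adj z.1 z.2).card : ℝ) := by
  set N := (P.filter fun z => G.Adj z.1 z.2).card with hN
  have hP : ∑ z ∈ P, ‖w z‖ ≤ (N : ℝ) := by
    calc ∑ z ∈ P, ‖w z‖ ≤ ∑ z ∈ P, (if G.Adj z.1 z.2 then (1 : ℝ) else 0) := Finset.sum_le_sum fun z _ => hw z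
      _ = (N : ℝ) := by rw [Finset.sum_boole, hN]
  have hmem : ∀ b ∈ S.filter (fun b : Bond Λ => G.Adj b.1 b.2.1),
      ((b.1, b.2.1), b.2.2) ∈ (P.filter fun z => G.Adj z.1 z.2) ×ˢ (Finset.univ : Finset (Fin 2)) := by
    intro b hb
    rw [Finset.mem_filter] at hb
    rw [Finset.mem_product, Finset.mem_filter]
    exact ⟨⟨hSP b hb.1 hb.2, hb.2⟩, Finset.mem_univ _⟩
  have hinj : Set.InjOn (fun b : Bond Λ => ((b.1, b.2.1), b.2.2)) (S.filter (fun b : Bond Λ => G.Adj b.1 b.2.1) : Set (Bond Λ)) := by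
    rintro ⟨x, y, σ⟩ _ ⟨x', y', σ'⟩ _ hbb
    simp only [Prod.mk.injEq] at hbb
    obtain ⟨⟨rfl, rfl⟩, rfl⟩ := hbb
    rfl
  have hcardB : ((S.filter fun b : Bond Λ => G.Adj b.1 b.2.1).card : ℝ) ≤ 2 * N := by
    have h := Finset.card_le_card_of_injOn _ hmem hinj
    rw [Finset.card_product, Finset.card_univ, Fintype.card_fin] at h
    have h' : ((S.filter fun b : Bond Λ => G.Adj b.1 b.2.1).card : ℝ) ≤ ((N * 2 : ℕ) : ℝ) := by exact_mod_cast h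
    push_cast at h'
    linarith
  have hB : ∑ b ∈ S, ‖hubbardCoupling G (t : ℂ) b‖ ≤ |t| * (2 * N) := by
    calc ∑ b ∈ S, ‖hubbardCoupling G (t : ℂ) b‖ = ∑ b ∈ S, |t| * (if G.Adj b.1 b.2.1 then (1 : ℝ) else 0) :=
          Finset.sum_congr rfl fun b _ => norm_hubbardCoupling_ofReal G t b
      _ = |t| * ((S.filter fun b : Bond Λ => G.Adj b.1 b.2.1).card : ℝ) := by rw [← Finset.mul_sum, Finset.sum_boole]
      _ ≤ |t| * (2 * N) := mul_le_mul_of_nonneg_left hcardB (abs_nonneg t)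
  have h4 : 0 ≤ 4 * |h| := by positivity
  nlinarith [hB, hP, mul_le_mul_of_nonneg_left hP h4, abs_nonneg t]

omit [LinearOrder Λ] in
/-- A sum of nearest-neighbour weights bounded by `1` is at most the number of ordered adjacent pairs. [folklore] -/
theorem sum_norm_weight_le_card (G : SimpleGraph Λ) [DecidableRel G.Adj] (w : Λ × Λ → ℂ)
    (hw : ∀ z, ‖w z‖ ≤ if G.Adj z.1 z.2 then 1 else 0) :
    ∑ z : Λ × Λ, ‖w z‖ ≤ (((Finset.univ : Finset (Λ × Λ)).filter fun z => G.Adj z.1 z.2).card : ℝ) := by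
  calc ∑ z : Λ × Λ, ‖w z‖ ≤ ∑ z : Λ × Λ, (if G.Adj z.1 z.2 then (1 : ℝ) else 0) := Finset.sum_le_sum fun z _ => hw z
    _ = (((Finset.univ : Finset (Λ × Λ)).filter fun z => G.Adj z.1 z.2).card : ℝ) := by rw [Finset.sum_boole]

omit [LinearOrder Λ] in
/-- Splitting a sum over all of a finite type along a pairwise disjoint family and the complement of its union.
[folklore] -/
theorem sum_univ_eq_sum_biUnion_add_sum_compl {α M : Type*} [Fintype α] [DecidableEq α] [AddCommMonoid M]
    {J : Type*} (T : Finset J) (A : J → Finset α) (hA : ∀ j ∈ T, ∀ j' ∈ T, j ≠ j' → Disjoint (A j) (A j'))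
    (F : α → M) : ∑ x, F x = ∑ j ∈ T, ∑ x ∈ A j, F x + ∑ x ∈ (T.biUnion A)ᶜ, F x := by
  rw [← Finset.sum_biUnion (fun j hj j' hj' hne => hA j hj j' hj' hne), ← Finset.sum_compl_add_sum (T.biUnion A),
    add_comm]

end Generic

/-! ### One embedded block -/

section Embed

variable {Λ Λ₁ : Type*} [LinearOrder Λ] [Fintype Λ] [LinearOrder Λ₁] [Fintype Λ₁]

/-- `e_* b_{xy} = b_{e x, e y}`. [folklore] -/
theorem jwEmbed_bondPair (e : Λ₁ ↪o Λ) (x y : Λ₁) :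
    jwEmbed (orbEmb e) (bondPair x y) = bondPair (e x) (e y) := by
  simp only [bondPair, map_sub, map_mul, jwEmbed_annihilation, orbEmb_orb]

/-- `e_* P_{w₁} = Σ_z w₁ z b_{e z₁, e z₂}`. [folklore] -/
theorem jwEmbed_pairSum (e : Λ₁ ↪o Λ) (w₁ : Λ₁ × Λ₁ → ℂ) :
    jwEmbed (orbEmb e) (∑ z : Λ₁ × Λ₁, w₁ z • bondPair z.1 z.2) = (∑ z : Λ₁ × Λ₁, w₁ z • bondPair ((e) z.1) ((e) z.2)) := by
  rw [map_sum]
  exact Finset.sum_congr rfl fun z _ => by rw [map_smul, jwEmbed_bondPair]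

/-- `jwEmbed` preserves Hermiticity. [folklore] -/
theorem isHermitian_jwEmbed_of_isHermitian (e : Λ₁ ↪o Λ) {H : Matrix (Finset (Orb Λ₁)) (Finset (Orb Λ₁)) ℂ}
    (hH : H.IsHermitian) : (jwEmbed (orbEmb e) H).IsHermitian := by
  rw [IsHermitian, ← jwEmbed_conjTranspose, hH.eq]

/-- **The embedded block Hamiltonian, intrinsic form**: `e_* H(G₁, w₁, μ) = V_{e Λ₁}(U, μ) − Σ_b c¹_b T_{e b} − h(e_* P₁ + h.c.)`.
[folklore] -/
theorem jwEmbed_sourced_eq_intrinsic (e : Λ₁ ↪o Λ) (G₁ : SimpleGraph Λ₁) [DecidableRel G₁.Adj] (t U μ h : ℝ)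
    (w₁ : Λ₁ × Λ₁ → ℂ) :
    jwEmbed (orbEmb e) (hamiltonianWith G₁ t U μ - (h : ℂ) • ((∑ z : Λ₁ × Λ₁, w₁ z • bondPair z.1 z.2) + (∑ z : Λ₁ × Λ₁, w₁ z • bondPair z.1 z.2)ᴴ)) =
      onSiteSum (U : ℂ) (μ : ℂ) ((Finset.univ : Finset Λ₁).map (e).toEmbedding) -
        (∑ b : Bond Λ₁, hubbardCoupling G₁ (t : ℂ) b • bondOp (bondMap e b)) -
        (h : ℂ) • ((∑ z : Λ₁ × Λ₁, w₁ z • bondPair ((e) z.1) ((e) z.2)) + (∑ z : Λ₁ × Λ₁, w₁ z • bondPair ((e) z.1) ((e) z.2))ᴴ) := by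
  have hT : jwEmbed (orbEmb e) (hopSum (hubbardCoupling G₁ (t : ℂ))) =
      ∑ b : Bond Λ₁, hubbardCoupling G₁ (t : ℂ) b • bondOp (bondMap e b) := by
    rw [hopSum, map_sum]
    exact Finset.sum_congr rfl fun b _ => by rw [map_smul, jwEmbed_bondOp]
  rw [hamiltonianWith_eq_onSiteSum_sub_hopSum, map_sub, map_sub, map_smul, map_add, jwEmbed_conjTranspose,
    jwEmbed_onSiteSum, hT, jwEmbed_pairSum]

/-- **The embedded block Hamiltonian, extrinsic form**: under compatibility of adjacency and weights,
`e_* H(G₁, w₁, μ) = V_{e Λ₁}(U, μ) − Σ_{b ∈ e(bonds)} c_b T_b − h(Σ_{z ∈ e(pairs)} w z b_z + h.c.)` with the couplings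
and weights of the BIG system. [folklore] -/
theorem jwEmbed_sourced_eq (e : Λ₁ ↪o Λ) (G : SimpleGraph Λ) [DecidableRel G.Adj] (G₁ : SimpleGraph Λ₁)
    [DecidableRel G₁.Adj] (hG : ∀ x y, G₁.Adj x y ↔ G.Adj (e x) (e y)) (t U μ h : ℝ) (w : Λ × Λ → ℂ)
    (w₁ : Λ₁ × Λ₁ → ℂ) (hw : ∀ z, w₁ z = w (Prod.map e e z)) :
    jwEmbed (orbEmb e) (hamiltonianWith G₁ t U μ - (h : ℂ) • ((∑ z : Λ₁ × Λ₁, w₁ z • bondPair z.1 z.2) + (∑ z : Λ₁ × Λ₁, w₁ z • bondPair z.1 z.2)ᴴ)) =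
      onSiteSum (U : ℂ) (μ : ℂ) ((Finset.univ : Finset Λ₁).map (e).toEmbedding) - (∑ b ∈ ((Finset.univ : Finset (Bond Λ₁)).map ⟨bondMap (e), bondMap_injective (e)⟩), hubbardCoupling G (t : ℂ) b • bondOp b) -
        (h : ℂ) • ((∑ z ∈ ((Finset.univ : Finset (Λ₁ × Λ₁)).map ⟨Prod.map (e) (e), (e).injective.prodMap (e).injective⟩), w z • bondPair z.1 z.2) + (∑ z ∈ ((Finset.univ : Finset (Λ₁ × Λ₁)).map ⟨Prod.map (e) (e), (e).injective.prodMap (e).injective⟩), w z • bondPair z.1 z.2)ᴴ) := by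
  have hc : ∀ b : Bond Λ₁, hubbardCoupling G₁ (t : ℂ) b = hubbardCoupling G (t : ℂ) (bondMap e b) := by
    intro b
    simp only [hubbardCoupling_apply, bondMap, hG]
  have hB : (∑ b : Bond Λ₁, hubbardCoupling G₁ (t : ℂ) b • bondOp (bondMap e b)) =
      ∑ b ∈ ((Finset.univ : Finset (Bond Λ₁)).map ⟨bondMap (e), bondMap_injective (e)⟩), hubbardCoupling G (t : ℂ) b • bondOp b := by
    rw [Finset.sum_map]
    exact Finset.sum_congr rfl fun b _ => by rw [hc]; rfl
  have hP : (∑ z : Λ₁ × Λ₁, w₁ z • bondPair ((e) z.1) ((e) z.2)) = (∑ z ∈ ((Finset.univ : Finset (Λ₁ × Λ₁)).map ⟨Prod.map (e) (e), (e).injective.prodMap (e).injective⟩), w z • bondPair z.1 z.2) := by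
    rw [Finset.sum_map]
    exact Finset.sum_congr rfl fun z _ => by rw [hw]; rfl
  rw [jwEmbed_sourced_eq_intrinsic, hB, hP]

/-- `‖e_* P₁‖ ≤ 2 Σ_z ‖w₁ z‖`. [folklore] -/
theorem norm_embeddedPairSum_le (e : Λ₁ ↪o Λ) (w₁ : Λ₁ × Λ₁ → ℂ) :
    ‖(∑ z : Λ₁ × Λ₁, w₁ z • bondPair ((e) z.1) ((e) z.2))‖ ≤ 2 * ∑ z : Λ₁ × Λ₁, ‖w₁ z‖ :=
  norm_sum_smul_le_mul_sum Finset.univ w₁ (fun z => bondPair (e z.1) (e z.2)) (fun _ _ => norm_bondPair_le_two _ _)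

/-! ### Number gradings of an embedded block -/

/-- **Blocks inside the graded region**: if `e Λ₁ ⊆ R`, only the pair source of `e_* H(G₁,w₁,μ)` fails to commute
with `N_{orbs R}`, and `[N, [X, N]]`-form double commutator `= 4h · e_*(P₁ + P₁ᴴ)`. [folklore] -/
theorem doubleComm_numberDiag_jwEmbed_sourced_of_subset [DecidableEq Λ] (e : Λ₁ ↪o Λ) (R : Finset Λ) (hR : ∀ x, e x ∈ R)
    (G₁ : SimpleGraph Λ₁) [DecidableRel G₁.Adj] (t U μ h : ℝ) (w₁ : Λ₁ × Λ₁ → ℂ) :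
    ((diagonal fun s : Finset (Orb Λ) => (((s ∩ orbs R).card : ℕ) : ℂ)) * (jwEmbed (orbEmb e) (hamiltonianWith G₁ t U μ - (h : ℂ) • ((∑ z : Λ₁ × Λ₁, w₁ z • bondPair z.1 z.2) + (∑ z : Λ₁ × Λ₁, w₁ z • bondPair z.1 z.2)ᴴ)) * (diagonal fun s : Finset (Orb Λ) => (((s ∩ orbs R).card : ℕ) : ℂ)) - (diagonal fun s : Finset (Orb Λ) => (((s ∩ orbs R).card : ℕ) : ℂ)) * jwEmbed (orbEmb e) (hamiltonianWith G₁ t U μ - (h : ℂ) • ((∑ z : Λ₁ × Λ₁, w₁ z • bondPair z.1 z.2) + (∑ z : Λ₁ × Λ₁, w₁ z • bondPair z.1 z.2)ᴴ))) - (jwEmbed (orbEmb e) (hamiltonianWith G₁ t U μ - (h : ℂ) • ((∑ z : Λ₁ × Λ₁, w₁ z • bondPair z.1 z.2) + (∑ z : Λ₁ × Λ₁, w₁ z • bondPair z.1 z.2)ᴴ)) * (diagonal fun s : Finset (Orb Λ) => (((s ∩ orbs R).card : ℕ) : ℂ)) - (diagonal fun s : Finset (Orb Λ) => (((s ∩ orbs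 R).card : ℕ) : ℂ)) * jwEmbed (orbEmb e) (hamiltonianWith G₁ t U μ - (h : ℂ) • ((∑ z : Λ₁ × Λ₁, w₁ z • bondPair z.1 z.2) + (∑ z : Λ₁ × Λ₁, w₁ z • bondPair z.1 z.2)ᴴ))) * (diagonal fun s : Finset (Orb Λ) => (((s ∩ orbs R).card : ℕ) : ℂ))) = (4 * h : ℂ) • ((∑ z : Λ₁ × Λ₁, w₁ z • bondPair ((e) z.1) ((e) z.2)) + (∑ z : Λ₁ × Λ₁, w₁ z • bondPair ((e) z.1) ((e) z.2))ᴴ) := by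
  rw [jwEmbed_sourced_eq_intrinsic]
  have hN := numberDiag_conjTranspose (orbs R)
  -- charges: on-site `0`, hopping `0`, pairs `-2`, adjoint pairs `+2`
  have hV : (diagonal fun s : Finset (Orb Λ) => (((s ∩ orbs R).card : ℕ) : ℂ)) * onSiteSum (U : ℂ) (μ : ℂ) ((Finset.univ : Finset Λ₁).map (e).toEmbedding) - onSiteSum (U : ℂ) (μ : ℂ) ((Finset.univ : Finset Λ₁).map (e).toEmbedding) * (diagonal fun s : Finset (Orb Λ) => (((s ∩ orbs R).card : ℕ) : ℂ)) = 0 :=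
    numberDiag_comm_onSiteSum _ _ _ _
  have hT : (diagonal fun s : Finset (Orb Λ) => (((s ∩ orbs R).card : ℕ) : ℂ)) * (∑ b : Bond Λ₁, hubbardCoupling G₁ (t : ℂ) b • bondOp (bondMap e b)) -
      (∑ b : Bond Λ₁, hubbardCoupling G₁ (t : ℂ) b • bondOp (bondMap e b)) * (diagonal fun s : Finset (Orb Λ) => (((s ∩ orbs R).card : ℕ) : ℂ)) = 0 := by
    have h0 := comm_sum_smul_of_comm_eq_smul Finset.univ (N := (diagonal fun s : Finset (Orb Λ) => (((s ∩ orbs R).card : ℕ) : ℂ)))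
      (X := fun b : Bond Λ₁ => bondOp (bondMap e b)) (hubbardCoupling G₁ (t : ℂ)) (q := 0) (fun b _ => by
        show (diagonal fun s : Finset (Orb Λ) => (((s ∩ orbs R).card : ℕ) : ℂ)) * (creation (orb (e b.1) b.2.2) * annihilation (orb (e b.2.1) b.2.2)) -
          creation (orb (e b.1) b.2.2) * annihilation (orb (e b.2.1) b.2.2) * (diagonal fun s : Finset (Orb Λ) => (((s ∩ orbs R).card : ℕ) : ℂ)) = _
        rw [numberDiag_comm_creation_mul_annihilation, if_pos (hR b.1), if_pos (hR b.2.1), sub_self, zero_smul, zero_smul])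
    rw [h0, zero_smul]
  have hP : (diagonal fun s : Finset (Orb Λ) => (((s ∩ orbs R).card : ℕ) : ℂ)) * (∑ z : Λ₁ × Λ₁, w₁ z • bondPair ((e) z.1) ((e) z.2)) - (∑ z : Λ₁ × Λ₁, w₁ z • bondPair ((e) z.1) ((e) z.2)) * (diagonal fun s : Finset (Orb Λ) => (((s ∩ orbs R).card : ℕ) : ℂ)) = (-2 : ℂ) • (∑ z : Λ₁ × Λ₁, w₁ z • bondPair ((e) z.1) ((e) z.2)) :=
    comm_sum_smul_of_comm_eq_smul Finset.univ w₁ (fun z _ => by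
      rw [numberDiag_comm_bondPair, if_pos (hR z.1), if_pos (hR z.2)]
      norm_num)
  have hP' := comm_conjTranspose_of_comm_eq_smul hN hP
  have hsP := doubleComm_of_comm_eq_smul hP
  have hsP' := doubleComm_of_comm_eq_smul hP'
  rw [doubleComm_sub, doubleComm_sub, doubleComm_smul, doubleComm_add, doubleComm_of_comm_eq_zero hV,
    doubleComm_of_comm_eq_zero hT, hsP, hsP']
  have e1 : ((-2 : ℂ)) ^ 2 = 4 := by norm_num
  have e2 : (-(star (-2 : ℂ))) ^ 2 = 4 := by
    rw [show star (-2 : ℂ) = -2 by simp]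
    norm_num
  rw [e1, e2]
  module

/-- **Blocks outside the graded region** commute with `N_{orbs R}`: the double commutator vanishes. [folklore] -/
theorem doubleComm_numberDiag_jwEmbed_sourced_of_disjoint [DecidableEq Λ] (e : Λ₁ ↪o Λ) (R : Finset Λ) (hR : ∀ x, e x ∉ R)
    (G₁ : SimpleGraph Λ₁) [DecidableRel G₁.Adj] (t U μ h : ℝ) (w₁ : Λ₁ × Λ₁ → ℂ) :
    ((diagonal fun s : Finset (Orb Λ) => (((s ∩ orbs R).card : ℕ) : ℂ)) * (jwEmbed (orbEmb e) (hamiltonianWith G₁ t U μ - (h : ℂ) • ((∑ z : Λ₁ × Λ₁, w₁ z • bondPair z.1 z.2) + (∑ z : Λ₁ × Λ₁, w₁ z • bondPair z.1 z.2)ᴴ)) * (diagonal fun s : Finset (Orb Λ) => (((s ∩ orbs R).card : ℕ) : ℂ)) - (diagonal fun s : Finset (Orb Λ) => (((s ∩ orbs R).card : ℕ) : ℂ)) * jwEmbed (orbEmb e) (hamiltonianWith G₁ t U μ - (h : ℂ) • ((∑ z : Λ₁ × Λ₁, w₁ z • bondPair z.1 z.2) + (∑ z : Λ₁ × Λ₁,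 w₁ z • bondPair z.1 z.2)ᴴ))) - (jwEmbed (orbEmb e) (hamiltonianWith G₁ t U μ - (h : ℂ) • ((∑ z : Λ₁ × Λ₁, w₁ z • bondPair z.1 z.2) + (∑ z : Λ₁ × Λ₁, w₁ z • bondPair z.1 z.2)ᴴ)) * (diagonal fun s : Finset (Orb Λ) => (((s ∩ orbs R).card : ℕ) : ℂ)) - (diagonal fun s : Finset (Orb Λ) => (((s ∩ orbs R).card : ℕ) : ℂ)) * jwEmbed (orbEmb e) (hamiltonianWith G₁ t U μ - (h : ℂ) • ((∑ z : Λ₁ × Λ₁, w₁ z • bondPair z.1 z.2) + (∑ z : Λ₁ × Λ₁, w₁ z • bondPair z.1 z.2)ᴴ))) * (diagonal fun s : Finset (Orb Λ) => (((s ∩ orbs R).card : ℕ) : ℂ))) = 0 := by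
  rw [jwEmbed_sourced_eq_intrinsic]
  have hN := numberDiag_conjTranspose (orbs R)
  have hV : (diagonal fun s : Finset (Orb Λ) => (((s ∩ orbs R).card : ℕ) : ℂ)) * onSiteSum (U : ℂ) (μ : ℂ) ((Finset.univ : Finset Λ₁).map (e).toEmbedding) - onSiteSum (U : ℂ) (μ : ℂ) ((Finset.univ : Finset Λ₁).map (e).toEmbedding) * (diagonal fun s : Finset (Orb Λ) => (((s ∩ orbs R).card : ℕ) : ℂ)) = 0 :=
    numberDiag_comm_onSiteSum _ _ _ _
  have hT : (diagonal fun s : Finset (Orb Λ) => (((s ∩ orbs R).card : ℕ) : ℂ)) * (∑ b : Bond Λ₁, hubbardCoupling G₁ (t : ℂ) b • bondOp (bondMap e b)) -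
      (∑ b : Bond Λ₁, hubbardCoupling G₁ (t : ℂ) b • bondOp (bondMap e b)) * (diagonal fun s : Finset (Orb Λ) => (((s ∩ orbs R).card : ℕ) : ℂ)) = 0 := by
    have h0 := comm_sum_smul_of_comm_eq_smul Finset.univ (N := (diagonal fun s : Finset (Orb Λ) => (((s ∩ orbs R).card : ℕ) : ℂ)))
      (X := fun b : Bond Λ₁ => bondOp (bondMap e b)) (hubbardCoupling G₁ (t : ℂ)) (q := 0) (fun b _ => by
        show (diagonal fun s : Finset (Orb Λ) => (((s ∩ orbs R).card : ℕ) : ℂ)) * (creation (orb (e b.1) b.2.2) * annihilation (orb (e b.2.1) b.2.2)) -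
          creation (orb (e b.1) b.2.2) * annihilation (orb (e b.2.1) b.2.2) * (diagonal fun s : Finset (Orb Λ) => (((s ∩ orbs R).card : ℕ) : ℂ)) = _
        rw [numberDiag_comm_creation_mul_annihilation, if_neg (hR b.1), if_neg (hR b.2.1), sub_self, zero_smul, zero_smul])
    rw [h0, zero_smul]
  have hP : (diagonal fun s : Finset (Orb Λ) => (((s ∩ orbs R).card : ℕ) : ℂ)) * (∑ z : Λ₁ × Λ₁, w₁ z • bondPair ((e) z.1) ((e) z.2)) - (∑ z : Λ₁ × Λ₁, w₁ z • bondPair ((e) z.1) ((e) z.2)) * (diagonal fun s : Finset (Orb Λ) => (((s ∩ orbs R).card : ℕ) : ℂ)) = (0 : ℂ) • (∑ z : Λ₁ × Λ₁, w₁ z • bondPair ((e) z.1) ((e) z.2)) :=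
    comm_sum_smul_of_comm_eq_smul Finset.univ w₁ (fun z _ => by
      rw [numberDiag_comm_bondPair, if_neg (hR z.1), if_neg (hR z.2)]
      norm_num)
  have hP' := comm_conjTranspose_of_comm_eq_smul hN hP
  rw [zero_smul] at hP
  rw [star_zero, neg_zero, zero_smul] at hP'
  rw [doubleComm_sub, doubleComm_sub, doubleComm_smul, doubleComm_add, doubleComm_of_comm_eq_zero hV,
    doubleComm_of_comm_eq_zero hT, doubleComm_of_comm_eq_zero hP, doubleComm_of_comm_eq_zero hP']
  simp

/-- Norm of the surviving double commutator: `‖4h · e_*(P₁ + P₁ᴴ)‖ ≤ 16|h| Σ_z ‖w₁ z‖`. [folklore] -/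
theorem norm_smul_embeddedPairSum_add_conjTranspose_le (e : Λ₁ ↪o Λ) (h : ℝ) (w₁ : Λ₁ × Λ₁ → ℂ) :
    ‖(4 * h : ℂ) • ((∑ z : Λ₁ × Λ₁, w₁ z • bondPair ((e) z.1) ((e) z.2)) + (∑ z : Λ₁ × Λ₁, w₁ z • bondPair ((e) z.1) ((e) z.2))ᴴ)‖ ≤ 16 * |h| * ∑ z : Λ₁ × Λ₁, ‖w₁ z‖ := by
  have h1 := norm_embeddedPairSum_le e w₁
  have h2 := norm_add_conjTranspose_le_two_mul (∑ z : Λ₁ × Λ₁, w₁ z • bondPair ((e) z.1) ((e) z.2))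
  have hn : ‖(4 * h : ℂ)‖ = 4 * |h| := by
    rw [show (4 * h : ℂ) = ((4 * h : ℝ) : ℂ) by push_cast; ring, Complex.norm_real, Real.norm_eq_abs, abs_mul,
      abs_of_pos (by norm_num : (0 : ℝ) < 4)]
  rw [norm_smul, hn]
  nlinarith [abs_nonneg h, h1, h2, norm_nonneg (∑ z : Λ₁ × Λ₁, w₁ z • bondPair ((e) z.1) ((e) z.2))]

end Embed

/-! ### A family of embedded blocks -/

section Blocks

variable {Λ Λ₁ : Type*} [LinearOrder Λ] [Fintype Λ] [LinearOrder Λ₁] [Fintype Λ₁] {J : Type*}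

omit [Fintype Λ] [Fintype Λ₁] in
/-- Disjoint ranges: the image site sets of distinct blocks are disjoint. [folklore] -/
theorem disjoint_map_of_ne_range (T : Finset J) (e : J → Λ₁ ↪o Λ)
    (hdisj : ∀ j ∈ T, ∀ j' ∈ T, j ≠ j' → ∀ x y, e j x ≠ e j' y) (s : J → Finset Λ₁) :
    ∀ j ∈ T, ∀ j' ∈ T, j ≠ j' → Disjoint ((s j).map (e j).toEmbedding) ((s j').map (e j').toEmbedding) := by
  intro j hj j' hj' hne
  rw [Finset.disjoint_left]
  intro x hx hx'
  obtain ⟨a, _, rfl⟩ := Finset.mem_map.1 hx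
  obtain ⟨b, _, hb⟩ := Finset.mem_map.1 hx'
  exact hdisj j hj j' hj' hne a b hb.symm

omit [Fintype Λ] [Fintype Λ₁] in
/-- Disjoint ranges: the image bond sets of distinct blocks are disjoint. [folklore] -/
theorem disjoint_map_bondMap_of_ne (T : Finset J) (e : J → Λ₁ ↪o Λ)
    (hdisj : ∀ j ∈ T, ∀ j' ∈ T, j ≠ j' → ∀ x y, e j x ≠ e j' y) (s : J → Finset (Bond Λ₁)) :
    ∀ j ∈ T, ∀ j' ∈ T, j ≠ j' →
      Disjoint ((s j).map ⟨bondMap (e j), bondMap_injective (e j)⟩) ((s j').map ⟨bondMap (e j'), bondMap_injective (e j')⟩) := by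
  intro j hj j' hj' hne
  rw [Finset.disjoint_left]
  intro b hb hb'
  obtain ⟨b₁, _, rfl⟩ := Finset.mem_map.1 hb
  obtain ⟨b₂, _, hb₂⟩ := Finset.mem_map.1 hb'
  exact hdisj j hj j' hj' hne b₁.1 b₂.1 (congrArg Prod.fst hb₂).symm

omit [Fintype Λ] [Fintype Λ₁] in
/-- Disjoint ranges: the image pair sets of distinct blocks are disjoint. [folklore] -/
theorem disjoint_map_prodMap_of_ne (T : Finset J) (e : J → Λ₁ ↪o Λ)
    (hdisj : ∀ j ∈ T, ∀ j' ∈ T, j ≠ j' → ∀ x y, e j x ≠ e j' y) (s : J → Finset (Λ₁ × Λ₁)) :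
    ∀ j ∈ T, ∀ j' ∈ T, j ≠ j' →
      Disjoint ((s j).map ⟨Prod.map (e j) (e j), (e j).injective.prodMap (e j).injective⟩)
        ((s j').map ⟨Prod.map (e j') (e j'), (e j').injective.prodMap (e j').injective⟩) := by
  intro j hj j' hj' hne
  rw [Finset.disjoint_left]
  intro z hz hz'
  obtain ⟨z₁, _, rfl⟩ := Finset.mem_map.1 hz
  obtain ⟨z₂, _, hz₂⟩ := Finset.mem_map.1 hz'
  exact hdisj j hj j' hj' hne z₁.1 z₂.1 (congrArg Prod.fst hz₂).symm

/-- **Cutting into blocks, the identity**: `H(G,w,μ) − Σ_{j ∈ T} (e_j)_* H(G₁,w₁,μ) − V_{(⋃_j e_j Λ₁)ᶜ}(U, μ)` is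
minus the bonds and pairs not inside a block (disjoint ranges, compatible adjacency and weights). [folklore] -/
theorem sourced_sub_sum_jwEmbed_sub_onSiteSum_eq [DecidableEq Λ] (T : Finset J) (e : J → Λ₁ ↪o Λ)
    (hdisj : ∀ j ∈ T, ∀ j' ∈ T, j ≠ j' → ∀ x y, e j x ≠ e j' y)
    (G : SimpleGraph Λ) [DecidableRel G.Adj] (G₁ : SimpleGraph Λ₁) [DecidableRel G₁.Adj]
    (hG : ∀ j ∈ T, ∀ x y, G₁.Adj x y ↔ G.Adj (e j x) (e j y)) (t U μ h : ℝ) (w : Λ × Λ → ℂ) (w₁ : Λ₁ × Λ₁ → ℂ)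
    (hw : ∀ j ∈ T, ∀ z, w₁ z = w (Prod.map (e j) (e j) z)) :
    (hamiltonianWith G t U μ - (h : ℂ) • ((∑ z : Λ × Λ, w z • bondPair z.1 z.2) + (∑ z : Λ × Λ, w z • bondPair z.1 z.2)ᴴ)) - ∑ j ∈ T, jwEmbed (orbEmb (e j)) (hamiltonianWith G₁ t U μ - (h : ℂ) • ((∑ z : Λ₁ × Λ₁, w₁ z • bondPair z.1 z.2) + (∑ z : Λ₁ × Λ₁, w₁ z • bondPair z.1 z.2)ᴴ)) - onSiteSum (U : ℂ) (μ : ℂ) (T.biUnion fun j => ((Finset.univ : Finset Λ₁).map (e j).toEmbedding))ᶜ =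
      -(∑ b ∈ (T.biUnion fun j => ((Finset.univ : Finset (Bond Λ₁)).map ⟨bondMap (e j), bondMap_injective (e j)⟩))ᶜ, hubbardCoupling G (t : ℂ) b • bondOp b) -
        (h : ℂ) • ((∑ z ∈ (T.biUnion fun j => ((Finset.univ : Finset (Λ₁ × Λ₁)).map ⟨Prod.map (e j) (e j), (e j).injective.prodMap (e j).injective⟩))ᶜ, w z • bondPair z.1 z.2) +
          (∑ z ∈ (T.biUnion fun j => ((Finset.univ : Finset (Λ₁ × Λ₁)).map ⟨Prod.map (e j) (e j), (e j).injective.prodMap (e j).injective⟩))ᶜ, w z • bondPair z.1 z.2)ᴴ) := by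
  -- the three splittings along the blocks
  have hV : onSiteSum (U : ℂ) (μ : ℂ) (Finset.univ : Finset Λ) =
      ∑ j ∈ T, onSiteSum (U : ℂ) (μ : ℂ) ((Finset.univ : Finset Λ₁).map (e j).toEmbedding) + onSiteSum (U : ℂ) (μ : ℂ) (T.biUnion fun j => ((Finset.univ : Finset Λ₁).map (e j).toEmbedding))ᶜ := by
    simp only [onSiteSum]
    exact sum_univ_eq_sum_biUnion_add_sum_compl T _ (disjoint_map_of_ne_range T e hdisj fun _ => Finset.univ) _
  have hT : hopSum (hubbardCoupling G (t : ℂ)) =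
      ∑ j ∈ T, (∑ b ∈ ((Finset.univ : Finset (Bond Λ₁)).map ⟨bondMap (e j), bondMap_injective (e j)⟩), hubbardCoupling G (t : ℂ) b • bondOp b) +
        ∑ b ∈ (T.biUnion fun j => ((Finset.univ : Finset (Bond Λ₁)).map ⟨bondMap (e j), bondMap_injective (e j)⟩))ᶜ, hubbardCoupling G (t : ℂ) b • bondOp b := by
    rw [hopSum]
    exact sum_univ_eq_sum_biUnion_add_sum_compl T _ (disjoint_map_bondMap_of_ne T e hdisj fun _ => Finset.univ) _
  have hP : (∑ z : Λ × Λ, w z • bondPair z.1 z.2) =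
      ∑ j ∈ T, (∑ z ∈ ((Finset.univ : Finset (Λ₁ × Λ₁)).map ⟨Prod.map (e j) (e j), (e j).injective.prodMap (e j).injective⟩), w z • bondPair z.1 z.2) + ∑ z ∈ (T.biUnion fun j => ((Finset.univ : Finset (Λ₁ × Λ₁)).map ⟨Prod.map (e j) (e j), (e j).injective.prodMap (e j).injective⟩))ᶜ, w z • bondPair z.1 z.2 :=
    sum_univ_eq_sum_biUnion_add_sum_compl T _ (disjoint_map_prodMap_of_ne T e hdisj fun _ => Finset.univ) _
  have hE : ∑ j ∈ T, jwEmbed (orbEmb (e j)) (hamiltonianWith G₁ t U μ - (h : ℂ) • ((∑ z : Λ₁ × Λ₁, w₁ z • bondPair z.1 z.2) + (∑ z : Λ₁ × Λ₁, w₁ z • bondPair z.1 z.2)ᴴ)) =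
      ∑ j ∈ T, (onSiteSum (U : ℂ) (μ : ℂ) ((Finset.univ : Finset Λ₁).map (e j).toEmbedding) - (∑ b ∈ ((Finset.univ : Finset (Bond Λ₁)).map ⟨bondMap (e j), bondMap_injective (e j)⟩), hubbardCoupling G (t : ℂ) b • bondOp b) -
        (h : ℂ) • ((∑ z ∈ ((Finset.univ : Finset (Λ₁ × Λ₁)).map ⟨Prod.map (e j) (e j), (e j).injective.prodMap (e j).injective⟩), w z • bondPair z.1 z.2) + (∑ z ∈ ((Finset.univ : Finset (Λ₁ × Λ₁)).map ⟨Prod.map (e j) (e j), (e j).injective.prodMap (e j).injective⟩), w z • bondPair z.1 z.2)ᴴ)) :=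
    Finset.sum_congr rfl fun j hj => jwEmbed_sourced_eq (e j) G G₁ (hG j hj) t U μ h w w₁ (hw j hj)
  rw [hE, hamiltonianWith_eq_onSiteSum_sub_hopSum, hV, hT, hP]
  simp only [Finset.sum_sub_distrib, Finset.smul_sum, Finset.sum_add_distrib, conjTranspose_add, conjTranspose_sum,
    smul_add]
  abel

/-- **Cutting into blocks, the bound** (Ruelle's boundary estimate): with nearest-neighbour weights bounded by `1`,
`‖H(G,w,μ) − Σ_j (e_j)_* H(G₁,w₁,μ) − V_{rest}(U, μ)‖ ≤ (2|t| + 4|h|) · #{ordered adjacent pairs not inside a block}`.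
[folklore] -/
theorem norm_sourced_sub_sum_jwEmbed_sub_onSiteSum_le [DecidableEq Λ] (T : Finset J) (e : J → Λ₁ ↪o Λ)
    (hdisj : ∀ j ∈ T, ∀ j' ∈ T, j ≠ j' → ∀ x y, e j x ≠ e j' y)
    (G : SimpleGraph Λ) [DecidableRel G.Adj] (G₁ : SimpleGraph Λ₁) [DecidableRel G₁.Adj]
    (hG : ∀ j ∈ T, ∀ x y, G₁.Adj x y ↔ G.Adj (e j x) (e j y)) (t U μ h : ℝ) (w : Λ × Λ → ℂ) (w₁ : Λ₁ × Λ₁ → ℂ)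
    (hw : ∀ j ∈ T, ∀ z, w₁ z = w (Prod.map (e j) (e j) z)) (hwle : ∀ z, ‖w z‖ ≤ if G.Adj z.1 z.2 then 1 else 0) :
    ‖(hamiltonianWith G t U μ - (h : ℂ) • ((∑ z : Λ × Λ, w z • bondPair z.1 z.2) + (∑ z : Λ × Λ, w z • bondPair z.1 z.2)ᴴ)) - ∑ j ∈ T, jwEmbed (orbEmb (e j)) (hamiltonianWith G₁ t U μ - (h : ℂ) • ((∑ z : Λ₁ × Λ₁, w₁ z • bondPair z.1 z.2) + (∑ z : Λ₁ × Λ₁, w₁ z • bondPair z.1 z.2)ᴴ)) - onSiteSum (U : ℂ) (μ : ℂ) (T.biUnion fun j => ((Finset.univ : Finset Λ₁).map (e j).toEmbedding))ᶜ‖ ≤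
      (2 * |t| + 4 * |h|) * ((((T.biUnion fun j => ((Finset.univ : Finset (Λ₁ × Λ₁)).map ⟨Prod.map (e j) (e j), (e j).injective.prodMap (e j).injective⟩))ᶜ).filter fun z => G.Adj z.1 z.2).card : ℝ) := by
  rw [sourced_sub_sum_jwEmbed_sub_onSiteSum_eq T e hdisj G G₁ hG t U μ h w w₁ hw]
  refine (norm_neg_bondSum_sub_pairSum_le _ _ _ h w).trans (bondSum_add_pairSum_le_card G t h w hwle _ _ ?_)
  -- a bond not inside a block with adjacent ends has its site pair not inside a block
  intro b hb _
  rw [Finset.mem_compl, Finset.mem_biUnion, not_exists] at hb ⊢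
  intro j ⟨hj, hz⟩
  refine hb j ⟨hj, ?_⟩
  obtain ⟨p, -, hp⟩ := Finset.mem_map.1 hz
  refine Finset.mem_map.2 ⟨(p.1, p.2, b.2.2), Finset.mem_univ _, ?_⟩
  simp only [Function.Embedding.coeFn_mk, Prod.map, Prod.mk.injEq] at hp
  simp only [Function.Embedding.coeFn_mk, bondMap, hp.1, hp.2]

/-- **Cutting into blocks, the bound with a counted boundary**: as `norm_sourced_sub_sum_jwEmbed_sub_onSiteSum_le`, with the
number of ordered adjacent pairs not inside a block replaced by any natural upper bound `B`. [folklore] -/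
theorem norm_sourced_sub_sum_jwEmbed_sub_onSiteSum_le_of_card_le [DecidableEq Λ] (T : Finset J) (e : J → Λ₁ ↪o Λ)
    (hdisj : ∀ j ∈ T, ∀ j' ∈ T, j ≠ j' → ∀ x y, e j x ≠ e j' y)
    (G : SimpleGraph Λ) [DecidableRel G.Adj] (G₁ : SimpleGraph Λ₁) [DecidableRel G₁.Adj]
    (hG : ∀ j ∈ T, ∀ x y, G₁.Adj x y ↔ G.Adj (e j x) (e j y)) (t U μ h : ℝ) (w : Λ × Λ → ℂ) (w₁ : Λ₁ × Λ₁ → ℂ)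
    (hw : ∀ j ∈ T, ∀ z, w₁ z = w (Prod.map (e j) (e j) z)) (hwle : ∀ z, ‖w z‖ ≤ if G.Adj z.1 z.2 then 1 else 0) {B : ℕ}
    (hB : (((T.biUnion fun j => ((Finset.univ : Finset (Λ₁ × Λ₁)).map ⟨Prod.map (e j) (e j), (e j).injective.prodMap (e j).injective⟩))ᶜ).filter fun z => G.Adj z.1 z.2).card ≤ B) :
    ‖(hamiltonianWith G t U μ - (h : ℂ) • ((∑ z : Λ × Λ, w z • bondPair z.1 z.2) + (∑ z : Λ × Λ, w z • bondPair z.1 z.2)ᴴ)) - ∑ j ∈ T, jwEmbed (orbEmb (e j)) (hamiltonianWith G₁ t U μ - (h : ℂ) • ((∑ z : Λ₁ × Λ₁, w₁ z • bondPair z.1 z.2) + (∑ z : Λ₁ × Λ₁, w₁ z • bondPair z.1 z.2)ᴴ)) - onSiteSum (U : ℂ) (μ : ℂ) (T.biUnion fun j => ((Finset.univ : Finset Λ₁).map (e j).toEmbedding))ᶜ‖ ≤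
      (2 * |t| + 4 * |h|) * (B : ℝ) :=
  (norm_sourced_sub_sum_jwEmbed_sub_onSiteSum_le T e hdisj G G₁ hG t U μ h w w₁ hw hwle).trans
    (mul_le_mul_of_nonneg_left (by exact_mod_cast hB) (by positivity))

/-- **Chemical potentials per block**: subtracting `Σ_j μ_j N_{e_j Λ₁} + μ_r N_{rest}` from the `μ = 0` block sum
gives the block sum at chemical potentials `μ_j`, with the atomic rest at `μ_r`. [folklore] -/
theorem sum_jwEmbed_sourced_shift [DecidableEq Λ] (T : Finset J) (e : J → Λ₁ ↪o Λ) (G₁ : SimpleGraph Λ₁) [DecidableRel G₁.Adj]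
    (t U h : ℝ) (w₁ : Λ₁ × Λ₁ → ℂ) (μ : J → ℝ) (μr : ℝ) (RR : Finset Λ) :
    (∑ j ∈ T, jwEmbed (orbEmb (e j)) (hamiltonianWith G₁ t U 0 - (h : ℂ) • ((∑ z : Λ₁ × Λ₁, w₁ z • bondPair z.1 z.2) + (∑ z : Λ₁ × Λ₁, w₁ z • bondPair z.1 z.2)ᴴ))) + onSiteSum (U : ℂ) 0 RR -
        (∑ j ∈ T, (μ j : ℂ) • (diagonal fun s : Finset (Orb Λ) => (((s ∩ orbs (((Finset.univ : Finset Λ₁).map (e j).toEmbedding))).card : ℕ) : ℂ))) - (μr : ℂ) • (diagonal fun s : Finset (Orb Λ) => (((s ∩ orbs RR).card : ℕ) : ℂ)) =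
      (∑ j ∈ T, jwEmbed (orbEmb (e j)) (hamiltonianWith G₁ t U (μ j) - (h : ℂ) • ((∑ z : Λ₁ × Λ₁, w₁ z • bondPair z.1 z.2) + (∑ z : Λ₁ × Λ₁, w₁ z • bondPair z.1 z.2)ᴴ))) + onSiteSum (U : ℂ) (μr : ℂ) RR := by
  -- the `ℂ`-algebra structure in the type of `jwEmbed` carries `LinearOrder.toDecidableEq`: substitute it
  obtain rfl : ‹DecidableEq Λ› = LinearOrder.toDecidableEq := Subsingleton.elim _ _
  have hj : ∀ j ∈ T, jwEmbed (orbEmb (e j)) (hamiltonianWith G₁ t U (μ j) - (h : ℂ) • ((∑ z : Λ₁ × Λ₁, w₁ z • bondPair z.1 z.2) + (∑ z : Λ₁ × Λ₁, w₁ z • bondPair z.1 z.2)ᴴ)) =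
      jwEmbed (orbEmb (e j)) (hamiltonianWith G₁ t U 0 - (h : ℂ) • ((∑ z : Λ₁ × Λ₁, w₁ z • bondPair z.1 z.2) + (∑ z : Λ₁ × Λ₁, w₁ z • bondPair z.1 z.2)ᴴ)) - (μ j : ℂ) • (diagonal fun s : Finset (Orb Λ) => (((s ∩ orbs (((Finset.univ : Finset Λ₁).map (e j).toEmbedding))).card : ℕ) : ℂ)) := by
    intro j _
    rw [hamiltonianWith_eq_sub_smul_totalNumber G₁ t U (μ j), sub_right_comm, map_sub, map_smul, jwEmbed_totalNumber]
  rw [Finset.sum_congr rfl hj, Finset.sum_sub_distrib, onSiteSum_eq_sub_smul_numberDiag (U : ℂ) (μr : ℂ) RR]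
  abel

/-- **Double commutators of a block trial Hamiltonian with the particle number of a union of blocks**:
for `T' ⊆ T` and `N = N_{⋃_{j ∈ T'} e_j Λ₁}`, `‖N(XN − NX) − (XN − NX)N‖ ≤ #T' · 16|h| Σ_z ‖w₁ z‖` for
`X = Σ_{j ∈ T} (e_j)_* H(G₁,w₁,0) + V_{RR}(U, 0)` (only the pair sources of the blocks in `T'` contribute). [folklore] -/
theorem norm_doubleComm_blockSum_le [DecidableEq Λ] [DecidableEq J] (T T' : Finset J) (hT' : T' ⊆ T) (e : J → Λ₁ ↪o Λ)
    (hdisj : ∀ j ∈ T, ∀ j' ∈ T, j ≠ j' → ∀ x y, e j x ≠ e j' y)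
    (G₁ : SimpleGraph Λ₁) [DecidableRel G₁.Adj] (t U h : ℝ) (w₁ : Λ₁ × Λ₁ → ℂ) (RR : Finset Λ) :
    ‖((diagonal fun s : Finset (Orb Λ) => (((s ∩ orbs (T'.biUnion fun j => ((Finset.univ : Finset Λ₁).map (e j).toEmbedding))).card : ℕ) : ℂ)) * (((∑ j ∈ T, jwEmbed (orbEmb (e j)) (hamiltonianWith G₁ t U 0 - (h : ℂ) • ((∑ z : Λ₁ × Λ₁, w₁ z • bondPair z.1 z.2) + (∑ z : Λ₁ × Λ₁, w₁ z • bondPair z.1 z.2)ᴴ))) + onSiteSum (U : ℂ) 0 RR) * (diagonal fun s : Finset (Orb Λ) => (((s ∩ orbs (T'.biUnion fun j => ((Finset.univ : Finset Λ₁).map (e j).toEmbedding))).card : ℕ) : ℂ)) - (diagonal fun s : Finset (Orb Λ) => (((s ∩ orbs (T'.biUnion fun j => ((Finset.univ : Finset Λ₁).map (e j).toEmbedding))).card : ℕ) : ℂ)) * ((∑ j ∈ T, jwEmbed (orbEmb (e j)) (hamiltonianWith G₁ t U 0 - (h : ℂ) • ((∑ z : Λ₁ × Λ₁, w₁ z •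 bondPair z.1 z.2) + (∑ z : Λ₁ × Λ₁, w₁ z • bondPair z.1 z.2)ᴴ))) + onSiteSum (U : ℂ) 0 RR)) - (((∑ j ∈ T, jwEmbed (orbEmb (e j)) (hamiltonianWith G₁ t U 0 - (h : ℂ) • ((∑ z : Λ₁ × Λ₁, w₁ z • bondPair z.1 z.2) + (∑ z : Λ₁ × Λ₁, w₁ z • bondPair z.1 z.2)ᴴ))) + onSiteSum (U : ℂ) 0 RR) * (diagonal fun s : Finset (Orb Λ) => (((s ∩ orbs (T'.biUnion fun j => ((Finset.univ : Finset Λ₁).map (e j).toEmbedding))).card : ℕ) : ℂ)) - (diagonal fun s : Finset (Orb Λ) => (((s ∩ orbs (T'.biUnion fun j => ((Finset.univ : Finset Λ₁).map (e j).toEmbedding))).card : ℕ) : ℂ)) * ((∑ j ∈ T, jwEmbed (orbEmb (e j)) (hamiltonianWith G₁ t U 0 - (h : ℂ) • ((∑ z : Λ₁ × Λ₁, w₁ z • bondPair z.1 z.2) + (∑ z : Λ₁ × Λ₁, w₁ z • bondPair z.1 z.2)ᴴ))) + onSiteSum (U : ℂ) 0 RR)) * (diagonal fun s : Finset (Orb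 Λ) => (((s ∩ orbs (T'.biUnion fun j => ((Finset.univ : Finset Λ₁).map (e j).toEmbedding))).card : ℕ) : ℂ)))‖ ≤
      T'.card * (16 * |h| * ∑ z : Λ₁ × Λ₁, ‖w₁ z‖) := by
  have hin : ∀ j ∈ T', ∀ x, e j x ∈ T'.biUnion fun j => ((Finset.univ : Finset Λ₁).map (e j).toEmbedding) := fun j hj x =>
    Finset.mem_biUnion.2 ⟨j, hj, Finset.mem_map.2 ⟨x, Finset.mem_univ _, rfl⟩⟩
  have hout : ∀ j ∈ T, j ∉ T' → ∀ x, e j x ∉ T'.biUnion fun j => ((Finset.univ : Finset Λ₁).map (e j).toEmbedding) := by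
    intro j hj hjT' x hx
    obtain ⟨j', hj', hx'⟩ := Finset.mem_biUnion.1 hx
    obtain ⟨y, -, hy⟩ := Finset.mem_map.1 hx'
    exact hdisj j hj j' (hT' hj') (fun hjj => hjT' (hjj ▸ hj')) x y hy.symm
  have hV := doubleComm_of_comm_eq_zero
    (numberDiag_comm_onSiteSum (orbs (T'.biUnion fun j => ((Finset.univ : Finset Λ₁).map (e j).toEmbedding))) (U : ℂ) 0 RR)
  rw [doubleComm_add, doubleComm_sum, hV, add_zero]
  have hterm : ∀ j ∈ T, ‖((diagonal fun s : Finset (Orb Λ) => (((s ∩ orbs (T'.biUnion fun j => ((Finset.univ : Finset Λ₁).map (e j).toEmbedding))).card : ℕ) : ℂ)) * (jwEmbed (orbEmb (e j)) (hamiltonianWith G₁ t U 0 - (h : ℂ) • ((∑ z : Λ₁ × Λ₁, w₁ z • bondPair z.1 z.2) + (∑ z : Λ₁ × Λ₁, w₁ z • bondPair z.1 z.2)ᴴ)) * (diagonal fun s : Finset (Orb Λ) => (((s ∩ orbs (T'.biUnion fun j => ((Finset.univ : Finset Λ₁).map (e j).toEmbedding))).card : ℕ) : ℂ)) - (diagonal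 fun s : Finset (Orb Λ) => (((s ∩ orbs (T'.biUnion fun j => ((Finset.univ : Finset Λ₁).map (e j).toEmbedding))).card : ℕ) : ℂ)) * jwEmbed (orbEmb (e j)) (hamiltonianWith G₁ t U 0 - (h : ℂ) • ((∑ z : Λ₁ × Λ₁, w₁ z • bondPair z.1 z.2) + (∑ z : Λ₁ × Λ₁, w₁ z • bondPair z.1 z.2)ᴴ))) - (jwEmbed (orbEmb (e j)) (hamiltonianWith G₁ t U 0 - (h : ℂ) • ((∑ z : Λ₁ × Λ₁, w₁ z • bondPair z.1 z.2) + (∑ z : Λ₁ × Λ₁, w₁ z • bondPair z.1 z.2)ᴴ)) * (diagonal fun s : Finset (Orb Λ) => (((s ∩ orbs (T'.biUnion fun j => ((Finset.univ : Finset Λ₁).map (e j).toEmbedding))).card : ℕ) : ℂ)) - (diagonal fun s : Finset (Orb Λ) => (((s ∩ orbs (T'.biUnion fun j => ((Finset.univ : Finset Λ₁).map (e j).toEmbedding))).card : ℕ) : ℂ)) * jwEmbed (orbEmb (e j)) (hamiltonianWith G₁ t U 0 - (h : ℂ) • ((∑ z : Λ₁ × Λ₁, w₁ z • bondPair z.1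 z.2) + (∑ z : Λ₁ × Λ₁, w₁ z • bondPair z.1 z.2)ᴴ))) * (diagonal fun s : Finset (Orb Λ) => (((s ∩ orbs (T'.biUnion fun j => ((Finset.univ : Finset Λ₁).map (e j).toEmbedding))).card : ℕ) : ℂ)))‖ ≤
      if j ∈ T' then 16 * |h| * ∑ z : Λ₁ × Λ₁, ‖w₁ z‖ else 0 := by
    intro j hj
    by_cases hjT' : j ∈ T'
    · rw [if_pos hjT', doubleComm_numberDiag_jwEmbed_sourced_of_subset (e j) _ (hin j hjT') G₁ t U 0 h w₁]
      exact norm_smul_embeddedPairSum_add_conjTranspose_le (e j) h w₁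
    · rw [if_neg hjT', doubleComm_numberDiag_jwEmbed_sourced_of_disjoint (e j) _ (hout j hj hjT') G₁ t U 0 h w₁, norm_zero]
  refine (norm_sum_le _ _).trans ((Finset.sum_le_sum hterm).trans ?_)
  rw [Finset.sum_ite_mem, Finset.inter_eq_right.2 hT', Finset.sum_const, nsmul_eq_mul]

/-- The block trial Hamiltonian `Σ_j (e_j)_* H(G₁,w₁,μ) + V_{RR}(U, μ')` is Hermitian. [folklore] -/
theorem isHermitian_blockSum (T : Finset J) (e : J → Λ₁ ↪o Λ) (G₁ : SimpleGraph Λ₁) [DecidableRel G₁.Adj]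
    (t U μ μ' h : ℝ) (w₁ : Λ₁ × Λ₁ → ℂ) (RR : Finset Λ) :
    ((∑ j ∈ T, jwEmbed (orbEmb (e j)) (hamiltonianWith G₁ t U μ - (h : ℂ) • ((∑ z : Λ₁ × Λ₁, w₁ z • bondPair z.1 z.2) + (∑ z : Λ₁ × Λ₁, w₁ z • bondPair z.1 z.2)ᴴ))) + onSiteSum (U : ℂ) (μ' : ℂ) RR).IsHermitian := by
  refine IsHermitian.add ?_ (isHermitian_onSiteSum_ofReal U μ' RR)
  rw [IsHermitian, conjTranspose_sum]
  exact Finset.sum_congr rfl fun j _ =>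
    (isHermitian_jwEmbed_of_isHermitian (e j) (isHermitian_sourced G₁ t U μ h w₁)).eq

end Blocks

end Literature.MathematicalPhysics.QuantumLattice
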